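import Literature.MathematicalPhysics.QuantumFieldTheory.Balaban1983to89.B9WalkLettersOpsO
import Summits.QuantumFields.YangMills.Theorems.BalabanUVNodesN06WalkLettersAtRecordRO
import Literature.MathematicalPhysics.QuantumFieldTheory.Balaban1983to89.B9Eq3124HZKnitPairReg335Y
import Literature.MathematicalPhysics.QuantumFieldTheory.Balaban1983to89.B9B8KnitLetterProjectionC
import Literature.MathematicalPhysics.QuantumFieldTheory.Balaban1983to89.Node00.OpsYRecordV11

/-!
# BalabanUVNodes ∕ N06 ([B9], `Dag.B9_main`) — CASCADE-K PIECE K2 (director-ym №383): THE rows-18 WALK-LETTER READERS OF `…N06WalkLettersAtRecordRO`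
# RE-PRESSED ONCE OVER A SITE-TRANSPORTER PARAMETER `parS`, THE TWO `parSymY`-SPECIFIC FACTS DISPLAYED AS LAWS

Track A of `YM-PLAN.md` (cell `pub-ymgap`, HUMAN RULING D-0062), node **N06** = [Balaban1985BackgroundPropagators] Thms 3.1–3.15; seat `pub-ymgap-dag-n06-d` (gen 24).
WHY.  `…N06WalkLettersAtRecordRO` (✓p770676) states `Identities₂` for the generic cube letter `O` and the two (3.88) local-inverse laws of today's letter AT THE
SYMMETRISED TRANSPORTER `parSymY`, closing two inputs by `parSymY`-specific facts: the averaging transporters are `SU(N)`-valued (`parSymY_mem`) and `Δ′_a(U; parSymY)`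
is a unit (Thm 3.11, `isUnit_deltaPrimeAY_parSymY` ∕ `isUnit_padDeltaY_parSymY`).  The knit certificate (CASCADE-K, director-ym №383) reads the same rows at PRINT's transporter
`parKnitY` ([Balaban1985Averaging] Prop. 2).  This file is the ONE parametric re-press: the transporter is a parameter `parS`, and the two facts are DISPLAYED LAWS at the
configuration — (KL1) the transporter's legs are unitary, `parS U z w ∈ U(N)`; (KL2) Thm 3.11's positivity `Δ′_a(U; parS) > 0` (which gives both the unit `Δ′_a(U)` and the
compressed units `(1_□̃ Δ′_a 1_□̃)` of (3.88)).
* §1 ★★ `identities₂_opsWalkYO_of_laws` — `Identities₂` at `(opsWalkYO, dirOpsWalkYO, dirLettersWalkYO) … parS … O` for a `U(N)`-valued configuration from (KL1), (KL2) and the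
  two (3.88) laws of `O` at that configuration; ★★ `identities₂_opsWalkYO_of_reg335R_laws` — the same read from a (3.35)-membership of the certificate's carrier
  `bg9YR M_N(ℂ) SU(N) R₁ R₂` with the laws supplied AT that member.
* §2 ★ `hloc_GsqY_of_posDefTr` ∕ ★ `hlocT_GsqY_of_posDefTr` — today's cube letter `GsqY … parS (cubeDomY x □)` satisfies the row and column laws at ANY transporter once
  (KL2) holds (node00-def-Y's `cutMulY_deltaPrimeAY_GsqY_cutMulY` ∕ `cutMulY_GsqY_deltaPrimeAY_cutMulY` with `isUnit_padDeltaY_of_posDefTr`).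
* §3 THE INSTANCES: at `parS := parSymY` the laws hold at every `SU(N)`-valued configuration (`parSymY_mem`, `padDeltaY_parSymY_posDefTr`'s source
  `deltaPrimeAY_parSymY_posDefTr`) — `identities₂_opsWalkYO_SU` of the RO file is recovered (`identities₂_opsWalkYO_SU_eq_laws`, by the laws); at `parS := parKnitY` they
  are dag-n06-l's `B9Eq3124HZKnitPairReg335Y.parKnitY_mem_unitary_of_reg335P` (KL1, on (3.35) with the knit numerics) and `B9B8KnitLetterProjectionC.thm311_firstThree_parKnitY`
  (KL2, from KL1) — ★★ `laws_parKnitY_of_reg335P` packages both for the knit certificate, and ★★ `lawsK_parKnitY_of_reg335P` adds the symmetry of `Δ′_a` and of `R`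
  (both letters) and `G′ > 0` (dag-n06-l `symm0_parKnitY ∕ RY_parKnitY_isSymmTr`, node00-def-Y `RY_GpPhysY_parKnitY_isSymmTr`) — the bundle every re-pressed reader consumes.
HONEST FRAMING.  Kernel bookkeeping over LANDED modules; the laws of a general transporter stay hypotheses; COUNT-NEUTRAL; NOT a discharge of N06; K1⁹ NOT closed; one finite
𝕋⁴ programme at fixed `ε` — NOT continuum ∕ OS ∕ mass gap ∕ Clay. 0 `def`, 0 `sorry`.  Cell `pub-ymgap` (D-0062), node N06 [B9], seat `pub-ymgap-dag-n06-d` (gen 24), 2026-08-30.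
[cite: Balaban1985BackgroundPropagators, (3.87)–(3.90) pp.408–410, (3.19) p.393, (3.24)–(3.27) pp.394–395, (3.35) p.396, Thm 3.11 p.416; Balaban1985Averaging, Prop. 2 p.26, (52)–(53) p.26;
Balaban1984PropagatorsII, (2.36)–(2.44) pp.229–230]
-/

noncomputable section

namespace Summit.QuantumFields.YangMills.BalabanUVNodes.N06WalkLettersAtRecordROPar

open Literature.MathematicalPhysics.QuantumFieldTheory.Balaban1983to89
open Literature.MathematicalPhysics.QuantumFieldTheory.Balaban1983to89.Node00
open Literature.MathematicalPhysics.QuantumFieldTheory.Balaban1983to89.B6KLevelCensusIndexV1 (KIdx kGeo)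
open Literature.MathematicalPhysics.QuantumFieldTheory.Balaban1983to89.B6Ineq2142KLevelV1 (β lvl)
open Literature.MathematicalPhysics.QuantumFieldTheory.Balaban1983to89.B6Cover236MultiLevelBlocks (cubes)
open Literature.MathematicalPhysics.QuantumFieldTheory.Balaban1983to89.B9PinMembersKLevelV1 (MemberY geo9Y)
open Literature.MathematicalPhysics.QuantumFieldTheory.Balaban1983to89.B7Prop2SpecialUnitary (specialUnitaryUnits specialUnitaryUnits_le_unitaryUnits)
open Literature.MathematicalPhysics.QuantumFieldTheory.Balaban1983to89.B7Prop2Explicit (unitaryUnits C0 c2')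
open Literature.MathematicalPhysics.QuantumFieldTheory.Balaban1983to89.B9Thm37Whole (Ops)
open Literature.MathematicalPhysics.QuantumFieldTheory.Balaban1983to89.B9RWSums346SecondDiffGp (DirOps37)
open Literature.MathematicalPhysics.QuantumFieldTheory.Balaban1983to89.B9Thm37WholeDir (DirLetters37 Identities₂)
open Literature.MathematicalPhysics.QuantumFieldTheory.Balaban1983to89.B9Thm37CubeCoverCommutators (cutMulY hTY)
open Literature.MathematicalPhysics.QuantumFieldTheory.Balaban1983to89.B9CoReadingCoordsTranspose (TrIdx trBasis)
open Literature.MathematicalPhysics.QuantumFieldTheory.Balaban1983to89.B9BackgroundsKLevelV1R (RegFamY MemOfFam bg9YR mem_of_reg335R)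
open Literature.MathematicalPhysics.QuantumFieldTheory.Balaban1983to89.B9BackgroundsKLevelV1P (bg9KP bg9YP)
open Literature.MathematicalPhysics.QuantumFieldTheory.Balaban1983to89.B9Thm311ReadingCoords (PosDefTr IsSymmTr isUnit_of_posDefTr)
open Literature.MathematicalPhysics.QuantumFieldTheory.Balaban1983to89.B9Thm311LocalInversePosY (isUnit_padDeltaY_of_posDefTr)
open Literature.MathematicalPhysics.QuantumFieldTheory.Balaban1983to89.B9Thm311DeltaPrimePos (deltaPrimeAY_parSymY_posDefTr)
open Literature.MathematicalPhysics.QuantumFieldTheory.Balaban1983to89.Node00.OpsYSectDCoords (cR39_trBasis_pos)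
open Literature.MathematicalPhysics.QuantumFieldTheory.Balaban1983to89.Node00.OpsYLocalInverse (GsqY cutMulY_deltaPrimeAY_GsqY_cutMulY)
open Literature.MathematicalPhysics.QuantumFieldTheory.Balaban1983to89.Node00.OpsYLeibnizLetters (cutMulY_GsqY_deltaPrimeAY_cutMulY)
open Literature.MathematicalPhysics.QuantumFieldTheory.Balaban1983to89.B9WalkLettersCoordsS (cubeDomY mem_cubeDomY_of_hTY_ne_zero)
open Literature.MathematicalPhysics.QuantumFieldTheory.Balaban1983to89.B9WalkLettersOpsO (opsWalkYO dirOpsWalkYO dirLettersWalkYO identities₂_opsWalkYO)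
open Literature.MathematicalPhysics.QuantumFieldTheory.Balaban1983to89.B9B8AveragingJunction (parKnitY)
open Literature.MathematicalPhysics.QuantumFieldTheory.Balaban1983to89.B9C2FormBoxRegimeY (Kpl)
open Literature.MathematicalPhysics.QuantumFieldTheory.Balaban1983to89.B9Eq3124HZKnitPairReg335Y (parKnitY_mem_unitary_of_reg335P)
open Literature.MathematicalPhysics.QuantumFieldTheory.Balaban1983to89.B9B8KnitLetterProjectionC (thm311_firstThree_parKnitY RY_parKnitY_isSymmTr)
open Literature.MathematicalPhysics.QuantumFieldTheory.Balaban1983to89.B9B8KnitLetterGpDecay (symm0_parKnitY)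

section Laws

open scoped Matrix.Norms.L2Operator

variable {d ℓ : ℕ} {hd : 1 ≤ d + 1} {hL : Odd (ℓ + 1) ∧ 1 < ℓ + 1} {b₀ b₁ : ℝ} {Mstar : ℕ} {N : ℕ} [NeZero N] [Nonempty (Fin N)]
variable (x : MemberY d ℓ hd hL b₀ b₁ Mstar) (B : B9.Backgrounds) (cfg : B.Cfg → CfgY (Matrix (Fin N) (Fin N) ℂ) x.toKIdx)
variable (bI : FBondY x.toKIdx → IBondY x.toKIdx) [Fintype (geo9Y x).Site] (parS : SiteParY (Matrix (Fin N) (Fin N) ℂ) x.toKIdx)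
variable (O : ↥(cubes x.toKIdx.D.toDomains) → SiteOpY (Matrix (Fin N) (Fin N) ℂ) x.toKIdx)

omit [NeZero N] [Fintype (geo9Y x).Site] in
/-- a unitary unit has operator norm at most one (the contraction input of the walk letters). [cite: Balaban1985BackgroundPropagators, pp.389–390 (G ⊂ U(N)), bookkeeping] -/
private theorem norm_le_one_of_mem_unitaryUnits {u : (Matrix (Fin N) (Fin N) ℂ)ˣ} (hu : u ∈ unitaryUnits (Matrix (Fin N) (Fin N) ℂ)) :
    ‖(u : Matrix (Fin N) (Fin N) ℂ)‖ ≤ 1 :=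
  (CStarRing.norm_of_mem_unitary (B7Prop2Explicit.mem_unitaryUnits.1 hu)).le

/-- ★★ **`Identities₂` AT THE GENERIC RECORD OVER A TRANSPORTER PARAMETER `parS`, FROM THE TWO DISPLAYED LAWS AT THE CONFIGURATION** — (KL1) the transporter's legs
are unitary, (KL2) `Δ′_a(U; parS) > 0` (Thm 3.11) — and the two (3.88) local-inverse laws of the cube letter `O` at that configuration (`U(N)`-valued).
[cite: Balaban1985BackgroundPropagators, (3.87)–(3.88) pp.408–409, (3.19) p.393, (3.24)–(3.27) pp.394–395, Thm 3.11 p.416; Balaban1984PropagatorsII, (2.39)–(2.40) pp.229–230] -/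
theorem identities₂_opsWalkYO_of_laws (R : ℝ) (H : Prop)
    (hβ1 : ∀ f : FBondY x.toKIdx, (B6Geom246MultiLevelTorus.geomT x.D).dist (β x.hN x.D x.hk (bI f)) (B6GlobalChartV1.blkV1 x.hN x.D f) ≤ 1)
    (hlev : ∀ f : FBondY x.toKIdx, lvl x.hN x.D x.hk (bI f) = (B6GlobalChartV1.blkV1 x.hN x.D f).1.1)
    (U : B.Cfg) (hU : ∀ μ y, cfg U μ y ∈ unitaryUnits (Matrix (Fin N) (Fin N) ℂ))
    (hparS : ∀ z w : SiteY x.toKIdx, parS (cfg U) z w ∈ unitaryUnits (Matrix (Fin N) (Fin N) ℂ))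
    (hΔ : PosDefTr (fun _ => (1 : ℝ)) (deltaPrimeAY x.toKIdx parS (cfg U)))
    (hloc : ∀ c : ↥(cubes x.toKIdx.D.toDomains),
      cutMulY (hTY x.toKIdx c) * deltaPrimeAY x.toKIdx parS (cfg U) * O c (cfg U) * cutMulY (hTY x.toKIdx c) = cutMulY (hTY x.toKIdx c) * cutMulY (hTY x.toKIdx c))
    (hlocT : ∀ c : ↥(cubes x.toKIdx.D.toDomains),
      cutMulY (hTY x.toKIdx c) * O c (cfg U) * deltaPrimeAY x.toKIdx parS (cfg U) * cutMulY (hTY x.toKIdx c) = cutMulY (hTY x.toKIdx c) * cutMulY (hTY x.toKIdx c)) :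
    Identities₂ (opsWalkYO x (trBasis N) B cfg parS bI O) (dirOpsWalkYO x (trBasis N) B cfg parS bI O) (dirLettersWalkYO x (trBasis N) B cfg parS bI O) R H U := by
  have h1 := fun (g : (Matrix (Fin N) (Fin N) ℂ)ˣ) (hg : g ∈ unitaryUnits (Matrix (Fin N) (Fin N) ℂ)) => norm_le_one_of_mem_unitaryUnits hg
  have hbox : ∀ (μ : Fin (d + 1)) (w : SiteY x.toKIdx), UboxY x.toKIdx (cfg U) μ w ∈ unitaryUnits (Matrix (Fin N) (Fin N) ℂ) := fun μ w => hU μ _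
  have havg : ∀ z w : SiteY x.toKIdx, avgTrY x.toKIdx parS (cfg U) z w ∈ unitaryUnits (Matrix (Fin N) (Fin N) ℂ) := fun z w =>
    Subgroup.mul_mem _ (hparS _ _) (hparS _ _)
  exact identities₂_opsWalkYO x (trBasis N) B cfg parS bI O R H hβ1 hlev (cR39_trBasis_pos (NeZero.pos N)).ne' U
    (fun μ w => ⟨h1 _ (hbox μ w), h1 _ (Subgroup.inv_mem _ (hbox μ w))⟩) (fun z w => ⟨h1 _ (havg z w), h1 _ (Subgroup.inv_mem _ (havg z w))⟩)
    (isUnit_of_posDefTr hΔ) hloc hlocT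

/-- ★★ **… READ FROM A (3.35)-MEMBERSHIP OF THE CERTIFICATE's CARRIER** `bg9YR M_N(ℂ) SU(N) R₁ R₂` (`cfg := id`), the two laws supplied AT that member: the shape of the knit
certificate's rows-18 `Identities₂` slot. [cite: Balaban1985BackgroundPropagators, (3.35) p.396, (3.87)–(3.88) pp.408–409, Thm 3.11 p.416] -/
theorem identities₂_opsWalkYO_of_reg335R_laws {R₁ R₂ : RegFamY d ℓ hd hL b₀ b₁ Mstar (Matrix (Fin N) (Fin N) ℂ)} (hGR : MemOfFam (specialUnitaryUnits (Fin N)) R₁)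
    (parS : SiteParY (Matrix (Fin N) (Fin N) ℂ) x.toKIdx) (O : ↥(cubes x.toKIdx.D.toDomains) → SiteOpY (Matrix (Fin N) (Fin N) ℂ) x.toKIdx) (R : ℝ) (H : Prop)
    (hβ1 : ∀ f : FBondY x.toKIdx, (B6Geom246MultiLevelTorus.geomT x.D).dist (β x.hN x.D x.hk (bI f)) (B6GlobalChartV1.blkV1 x.hN x.D f) ≤ 1)
    (hlev : ∀ f : FBondY x.toKIdx, lvl x.hN x.D x.hk (bI f) = (B6GlobalChartV1.blkV1 x.hN x.D f).1.1)
    {c α₀ : ℝ} {U : (bg9YR (Matrix (Fin N) (Fin N) ℂ) (specialUnitaryUnits (Fin N)) R₁ R₂ x).Cfg}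
    (hU : (bg9YR (Matrix (Fin N) (Fin N) ℂ) (specialUnitaryUnits (Fin N)) R₁ R₂ x).Reg335 c α₀ U)
    (hparS : ∀ z w : SiteY x.toKIdx, parS U z w ∈ unitaryUnits (Matrix (Fin N) (Fin N) ℂ)) (hΔ : PosDefTr (fun _ => (1 : ℝ)) (deltaPrimeAY x.toKIdx parS U))
    (hloc : ∀ c : ↥(cubes x.toKIdx.D.toDomains),
      cutMulY (hTY x.toKIdx c) * deltaPrimeAY x.toKIdx parS U * O c U * cutMulY (hTY x.toKIdx c) = cutMulY (hTY x.toKIdx c) * cutMulY (hTY x.toKIdx c))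
    (hlocT : ∀ c : ↥(cubes x.toKIdx.D.toDomains),
      cutMulY (hTY x.toKIdx c) * O c U * deltaPrimeAY x.toKIdx parS U * cutMulY (hTY x.toKIdx c) = cutMulY (hTY x.toKIdx c) * cutMulY (hTY x.toKIdx c)) :
    Identities₂ (opsWalkYO x (trBasis N) (bg9YR (Matrix (Fin N) (Fin N) ℂ) (specialUnitaryUnits (Fin N)) R₁ R₂ x) (fun U => U) parS bI O)
      (dirOpsWalkYO x (trBasis N) (bg9YR (Matrix (Fin N) (Fin N) ℂ) (specialUnitaryUnits (Fin N)) R₁ R₂ x) (fun U => U) parS bI O)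
      (dirLettersWalkYO x (trBasis N) (bg9YR (Matrix (Fin N) (Fin N) ℂ) (specialUnitaryUnits (Fin N)) R₁ R₂ x) (fun U => U) parS bI O) R H U :=
  identities₂_opsWalkYO_of_laws x (bg9YR (Matrix (Fin N) (Fin N) ℂ) (specialUnitaryUnits (Fin N)) R₁ R₂ x) (fun U => U) bI parS O R H hβ1 hlev U
    (fun μ y => specialUnitaryUnits_le_unitaryUnits (mem_of_reg335R hGR x hU μ y)) hparS hΔ hloc hlocT

end Laws

/-! ## §2 Today's cube letter satisfies the two (3.88) laws at ANY transporter with `Δ′_a(U; parS) > 0` -/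

section Letter

open scoped Matrix.Norms.L2Operator

variable {d ℓ : ℕ} {hd : 1 ≤ d + 1} {hL : Odd (ℓ + 1) ∧ 1 < ℓ + 1} {b₀ b₁ : ℝ} {Mstar : ℕ} {N : ℕ}
variable (x : MemberY d ℓ hd hL b₀ b₁ Mstar) (parS : SiteParY (Matrix (Fin N) (Fin N) ℂ) x.toKIdx)

/-- ★ **THE ROW LAW AT ANY TRANSPORTER**: `h_□·Δ′_a(U; parS)·GsqY … parS (cubeDomY x □) U·h_□ = h_□²` once `Δ′_a(U; parS) > 0` (compressed unit by `isUnit_padDeltaY_of_posDefTr`).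
[cite: Balaban1985BackgroundPropagators, (3.87)–(3.88) p.409, (3.27) p.395, Thm 3.11 p.416] -/
theorem hloc_GsqY_of_posDefTr {U : CfgY (Matrix (Fin N) (Fin N) ℂ) x.toKIdx} (hΔ : PosDefTr (fun _ => (1 : ℝ)) (deltaPrimeAY x.toKIdx parS U))
    (c : ↥(cubes x.toKIdx.D.toDomains)) :
    cutMulY (hTY x.toKIdx c) * deltaPrimeAY x.toKIdx parS U * GsqY x.toKIdx parS (cubeDomY x c) U * cutMulY (hTY x.toKIdx c)
      = cutMulY (hTY x.toKIdx c) * cutMulY (hTY x.toKIdx c) :=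
  cutMulY_deltaPrimeAY_GsqY_cutMulY x.toKIdx parS (isUnit_padDeltaY_of_posDefTr x.toKIdx (fun _ => one_pos) parS (cubeDomY x c) hΔ)
    (hTY x.toKIdx c) (fun _ hz => mem_cubeDomY_of_hTY_ne_zero x c hz)

/-- ★ **… AND THE COLUMN LAW AT ANY TRANSPORTER**: `h_□·GsqY … parS (cubeDomY x □) U·Δ′_a(U; parS)·h_□ = h_□²`. [cite: Balaban1985BackgroundPropagators, (3.87)–(3.88) p.409, Thm 3.11 p.416] -/
theorem hlocT_GsqY_of_posDefTr {U : CfgY (Matrix (Fin N) (Fin N) ℂ) x.toKIdx} (hΔ : PosDefTr (fun _ => (1 : ℝ)) (deltaPrimeAY x.toKIdx parS U))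
    (c : ↥(cubes x.toKIdx.D.toDomains)) :
    cutMulY (hTY x.toKIdx c) * GsqY x.toKIdx parS (cubeDomY x c) U * deltaPrimeAY x.toKIdx parS U * cutMulY (hTY x.toKIdx c)
      = cutMulY (hTY x.toKIdx c) * cutMulY (hTY x.toKIdx c) :=
  cutMulY_GsqY_deltaPrimeAY_cutMulY x.toKIdx parS (isUnit_padDeltaY_of_posDefTr x.toKIdx (fun _ => one_pos) parS (cubeDomY x c) hΔ)
    (hTY x.toKIdx c) (fun _ hz => mem_cubeDomY_of_hTY_ne_zero x c hz)

end Letter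

/-! ## §3 The instances: `parSymY` (every `SU(N)`-valued configuration) and `parKnitY` (on (3.35), with the knit numerics) -/

section Instances

open scoped Matrix.Norms.L2Operator

variable {d ℓ : ℕ} {hd : 1 ≤ d + 1} {hL : Odd (ℓ + 1) ∧ 1 < ℓ + 1} {b₀ b₁ : ℝ} {Mstar : ℕ} {N : ℕ}
variable (x : MemberY d ℓ hd hL b₀ b₁ Mstar)

/-- ★ the two laws at the SYMMETRISED transporter hold at every `SU(N)`-valued configuration (`parSymY_mem`, Thm 3.11's `deltaPrimeAY_parSymY_posDefTr`): today's instance.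
[cite: Balaban1985BackgroundPropagators, (3.19) p.393, Thm 3.11 p.416] -/
theorem laws_parSymY_SU {U : CfgY (Matrix (Fin N) (Fin N) ℂ) x.toKIdx} (hU : ∀ μ y, U μ y ∈ specialUnitaryUnits (Fin N)) :
    (∀ z w : SiteY x.toKIdx, parSymY x.toKIdx U z w ∈ unitaryUnits (Matrix (Fin N) (Fin N) ℂ)) ∧
      PosDefTr (fun _ => (1 : ℝ)) (deltaPrimeAY x.toKIdx (parSymY x.toKIdx) U) :=
  ⟨fun z w => specialUnitaryUnits_le_unitaryUnits (parSymY_mem x.toKIdx hU z w),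
    deltaPrimeAY_parSymY_posDefTr x.toKIdx specialUnitaryUnits_le_unitaryUnits hU⟩

/-- ★★ **THE TWO LAWS AT PRINT's KNIT TRANSPORTER ON THE REGIME OF RECORD** (dag-n06-l): at an `SU(N)`-valued member of print's class `(bg9KP … SU(N) x.toKIdx).Reg335 c₀ α₀ U`
(`c₀ ≤ 10`, `0 ≤ Mα₀`) with the x-free knit numerics `0 < α₀′`, `C₀α₀′ ≤ 1/3`, `2α₀′ ≤ c₂′` and the plaquette threshold `K_pl(Mα₀)·L⁴ < α₀′`, the knit legs are unitary
(`parKnitY_mem_unitary_of_reg335P`) and `Δ′_a(U; parKnitY) > 0` (`thm311_firstThree_parKnitY` at `G := U(N)`).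
[cite: Balaban1985BackgroundPropagators, (3.19) p.393, (3.35) p.396, Thm 3.11 p.416; Balaban1985Averaging, Prop. 2 p.26, (52)–(53) p.26] -/
theorem laws_parKnitY_of_reg335P [Nonempty (Fin N)] {c₀ α₀ : ℝ} (hc : c₀ ≤ 10) (hMα : 0 ≤ (kGeo x.toKIdx).M * α₀)
    {α₀' : ℝ} (hα' : 0 < α₀') (hα3 : C0 (d + 1) * α₀' ≤ 1 / 3) (hα2 : 2 * α₀' ≤ c2' (d + 1) (ℓ + 1))
    (hK : Kpl x.toKIdx ((kGeo x.toKIdx).M * α₀) * (kGeo x.toKIdx).L ^ 4 < α₀')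
    {U : CfgY (Matrix (Fin N) (Fin N) ℂ) x.toKIdx} (hUS : ∀ μ y, U μ y ∈ specialUnitaryUnits (Fin N))
    (hreg : (bg9KP (Matrix (Fin N) (Fin N) ℂ) (specialUnitaryUnits (Fin N)) x.toKIdx).Reg335 c₀ α₀ U) :
    (∀ z w : SiteY x.toKIdx, parKnitY x.toKIdx U z w ∈ unitaryUnits (Matrix (Fin N) (Fin N) ℂ)) ∧
      PosDefTr (fun _ => (1 : ℝ)) (deltaPrimeAY x.toKIdx (parKnitY x.toKIdx) U) := by
  have hpar : ∀ z w : SiteY x.toKIdx, parKnitY x.toKIdx U z w ∈ unitaryUnits (Matrix (Fin N) (Fin N) ℂ) := fun z w =>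
    parKnitY_mem_unitary_of_reg335P x.toKIdx (fun u hu => (CStarRing.norm_of_mem_unitary (B7Prop2Explicit.mem_unitaryUnits.1 (specialUnitaryUnits_le_unitaryUnits hu))).le)
      specialUnitaryUnits_le_unitaryUnits U hc hMα hreg hα' hα3 hα2 hK z w
  exact ⟨hpar, (thm311_firstThree_parKnitY x.toKIdx le_rfl (fun μ y => specialUnitaryUnits_le_unitaryUnits (hUS μ y)) hpar).1⟩

/-- ★★ **THE FULL TRANSPORTER LAW BUNDLE AT PRINT's KNIT TRANSPORTER ON THE REGIME OF RECORD** (the CASCADE-K readers' inputs, one call per member): (KL1) the knit legs are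
unitary; (KL2) `Δ′_a(U; parKnitY) > 0`; (KL3) `Δ′_a(U; parKnitY)` is trace-symmetric (dag-n06-l `symm0_parKnitY`); (KL4) `R(U; parKnitY, G′)` is trace-symmetric at both letters
`GpY ∕ GpPhysY` (dag-n06-l `RY_parKnitY_isSymmTr`, node00-def-Y `RY_GpPhysY_parKnitY_isSymmTr`); (KL5) `G′(U; parKnitY) > 0` — all at `G := U(N)` from (KL1).
[cite: Balaban1985BackgroundPropagators, (3.19) p.393, (3.24)–(3.25) p.394, (3.35) p.396, Thm 3.11 p.416; Balaban1985Averaging, Prop. 2 p.26, (52)–(53) p.26] -/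
theorem lawsK_parKnitY_of_reg335P [Nonempty (Fin N)] {c₀ α₀ : ℝ} (hc : c₀ ≤ 10) (hMα : 0 ≤ (kGeo x.toKIdx).M * α₀)
    {α₀' : ℝ} (hα' : 0 < α₀') (hα3 : C0 (d + 1) * α₀' ≤ 1 / 3) (hα2 : 2 * α₀' ≤ c2' (d + 1) (ℓ + 1))
    (hK : Kpl x.toKIdx ((kGeo x.toKIdx).M * α₀) * (kGeo x.toKIdx).L ^ 4 < α₀')
    {U : CfgY (Matrix (Fin N) (Fin N) ℂ) x.toKIdx} (hUS : ∀ μ y, U μ y ∈ specialUnitaryUnits (Fin N))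
    (hreg : (bg9KP (Matrix (Fin N) (Fin N) ℂ) (specialUnitaryUnits (Fin N)) x.toKIdx).Reg335 c₀ α₀ U) :
    (∀ z w : SiteY x.toKIdx, parKnitY x.toKIdx U z w ∈ unitaryUnits (Matrix (Fin N) (Fin N) ℂ)) ∧
      PosDefTr (fun _ => (1 : ℝ)) (deltaPrimeAY x.toKIdx (parKnitY x.toKIdx) U) ∧
      IsSymmTr (fun _ => (1 : ℝ)) (deltaPrimeAY x.toKIdx (parKnitY x.toKIdx) U) ∧
      IsSymmTr (fun _ => (1 : ℝ)) (RY x.toKIdx (parKnitY x.toKIdx) (GpY x.toKIdx (parKnitY x.toKIdx)) U) ∧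
      IsSymmTr (fun _ => (1 : ℝ)) (RY x.toKIdx (parKnitY x.toKIdx) (GpPhysY x.toKIdx (parKnitY x.toKIdx)) U) ∧
      PosDefTr (fun _ => (1 : ℝ)) (GpY x.toKIdx (parKnitY x.toKIdx) U) := by
  obtain ⟨hpar, hΔ⟩ := laws_parKnitY_of_reg335P x hc hMα hα' hα3 hα2 hK hUS hreg
  have hUU : ∀ μ y, U μ y ∈ unitaryUnits (Matrix (Fin N) (Fin N) ℂ) := fun μ y => specialUnitaryUnits_le_unitaryUnits (hUS μ y)
  exact ⟨hpar, hΔ, symm0_parKnitY x.toKIdx le_rfl hUU hpar, RY_parKnitY_isSymmTr x.toKIdx le_rfl hUU hpar,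
    RY_GpPhysY_parKnitY_isSymmTr x.toKIdx le_rfl hUU hpar, (thm311_firstThree_parKnitY x.toKIdx le_rfl hUU hpar).2.1⟩

end Instances

end Summit.QuantumFields.YangMills.BalabanUVNodes.N06WalkLettersAtRecordROPar

end
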